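import Literature.AlgebraicGeometry.GroupSchemes.AdmissibleIdealTransport   -- ★ `ker_appTop_comp_eq_comap` (⟹ ★ `HopfIdealOfClosedSubgroup`: `ker_appTop_quotIncl`, `ker_ptEquiv_isoSpecOver_inv_comp_eq`; ⟹ ★ `HopfIdealClosedSubgroup`: `quotIncl`, `exists_comp_quotIncl_eq_of_affine`)
import HarnessLib

/-!
# The closed subscheme `V(I) ↪ G —φ→ G′` factors through `V(Γ(φ)⁻¹ I) ↪ G′`; a morphism killing `V(Γ(φ)⁻¹ I)` kills `V(I)` after `φ`

Topic `Literature/AlgebraicGeometry/GroupSchemes`; namespace `Literature.AlgebraicGeometry.GroupSchemes.AdmIdealTransport` (sequel of ★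
`AdmissibleIdealTransport` §2 `ker_appTop_comp_eq_comap`).  THEOREMS ONLY (no definition, no named fact, no `instance`, no notation, no `sorry`);
ANY commutative ring `R`, ANY affine `R`-schemes `G G′`, ANY morphism `φ : G ⟶ G′` (no group structure on `G`, `G′`, no isomorphism), any ideal
`I ⊂ Γ(G, 𝒪_G)`.  Cell `hodgecm-mathlib` (D-0151), P6 «MOD programme», half A line L2, closer leaf `Lines/F0_P6a_StubDOWN.lean` of the D-LINE socket
`stub_DOWN`, organ `stub_TRANSPORT`, §E row (E8) «`IsogKerLaw` TRANSPORTED» (LA2-plan (g0) DEAL (B) 2026-09-02T03:51:54Z to LA6-p01 (g2); ★-filing word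
04:03:04Z): the generic engine under the dock row «if the sheet layer map kills `V(Γ(φ)⁻¹ H)` then the conjugated layer map `φ ≫ isogW₀ ≫ ψ` kills `V(H)`».
`--supports stmt-HodgeConjecture-24832`, count-neutral.  HONEST LABEL: HC_CM is proved only modulo the 2 remaining named inputs (hLiu418 24832, h413 24833)
until rung 0 closes; this file is generic and discharges none of them.

THE PRINT.  [GortzWedhorn2023] (27.1.1), §(27.2) (p. 607) ∕ [Waterhouse1979] §2.1: for an affine scheme `G = Spec A` over `R`, closed subschemes
`V(I) = Spec (A ⧸ I) ↪ G` ↔ ideals `I ⊂ A` (★ `quotIncl G I`), and a point `u : Spec R′ → G` factors through `V(I)` iff its algebra map kills `I` (★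
`exists_comp_quotIncl_eq_iff_le_ker`).  For a morphism `φ : G → G′` of affine `R`-schemes the composite `V(I) ↪ G → G′` has ideal
`ker Γ(quotIncl ≫ φ) = Γ(φ)⁻¹ (ker Γ(quotIncl)) = Γ(φ)⁻¹ I` (★ `ker_appTop_comp_eq_comap`, ★ `ker_appTop_quotIncl`), so it FACTORS THROUGH
`V(Γ(φ)⁻¹ I) ↪ G′` (§1) — for an isomorphism `φ` this is «`φ` carries `V(I)` onto `V(Γ(φ)⁻¹ I)`», the closed-subscheme side of ★ `AdmissibleIdealTransport`.
Consequently (§2), for a monoid object `M` over `R` and `g : G′ → M` with `V(Γ(φ)⁻¹ I) ↪ G′ —g→ M` trivial, `V(I) ↪ G —φ→ G′ —g→ M` is trivial (Mathlib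
`MonObj.comp_one`), and stays trivial after any homomorphism `χ : M → M′` (`MonObj.one_comp`).

## Contents
* §1 **`exists_comp_quotIncl_comap_eq`** — `∃ y, y ≫ quotIncl G′ (Γ(φ)⁻¹ I) = quotIncl G I ≫ φ`.
* §2 **`quotIncl_comp_eq_one_of_comap`** — `quotIncl G′ (Γ(φ)⁻¹ I) ≫ g = 1 → quotIncl G I ≫ φ ≫ g = 1`;
  **`quotIncl_comp_comp_eq_one_of_comap`** — the same followed by a homomorphism `χ`: `quotIncl G I ≫ (φ ≫ g ≫ χ) = 1`.

## References
* [GortzWedhorn2023] U. Görtz, T. Wedhorn, *Algebraic Geometry II* (2023) — (27.1.1), §(27.2) (27.2.1), p. 607.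
* [Waterhouse1979] W. C. Waterhouse, *Introduction to Affine Group Schemes*, GTM 66 (1979) — §2.1 (closed subgroups and Hopf ideals).
* Tree: ★ `GroupSchemes/AdmissibleIdealTransport`, ★ `GroupSchemes/HopfIdealOfClosedSubgroup`, ★ `GroupSchemes/HopfIdealClosedSubgroup`.
-/

set_option autoImplicit false

-- Mathlib's `Over`/`Scheme` APIs are stated across semireducible wrappers (as in ★ `GroupSchemes/*`).
set_option backward.isDefEq.respectTransparency false

noncomputable section

open CategoryTheory CategoryTheory.Limits AlgebraicGeometry MonoidalCategory CartesianMonoidalCategory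

open scoped MonObj

universe u

namespace Literature.AlgebraicGeometry.GroupSchemes.AdmIdealTransport

open Literature.AlgebraicGeometry.Motives AffineGroupScheme

variable {R : Type u} [CommRing R] {G G' : SchemeOver R} [IsAffine G.left] [IsAffine G'.left]

/-! ## §1 `V(I) ↪ G —φ→ G′` factors through `V(Γ(φ)⁻¹ I) ↪ G′` -/

/-- **THE CLOSED SUBSCHEME `V(I) ↪ G —φ→ G′` FACTORS THROUGH `V(Γ(φ)⁻¹ I) ↪ G′`** for ANY morphism of affine `R`-schemes `φ : G ⟶ G′` and any ideal
`I ⊂ Γ(G, 𝒪)`: the ideal of the (affine) point `quotIncl G I ≫ φ` is `ker Γ(quotIncl G I ≫ φ) = Γ(φ)⁻¹ (ker Γ(quotIncl G I)) = Γ(φ)⁻¹ I` (★ `ker_appTop_comp_eq_comap`,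
★ `ker_appTop_quotIncl`), so the points criterion (★ `exists_comp_quotIncl_eq_of_affine`, ★ `ker_ptEquiv_isoSpecOver_inv_comp_eq`) factors it.
[cite: GortzWedhorn2023, (27.1.1) and §(27.2) (p. 607)] [cite: Waterhouse1979, §2.1] -/
theorem exists_comp_quotIncl_comap_eq (φ : G ⟶ G') (I : Ideal (Alg G)) :
    ∃ y : Motives.specOver R (Alg G ⧸ I) ⟶ Motives.specOver R (Alg G' ⧸ (I.comap φ.left.appTop.hom : Ideal (Alg G'))),
      y ≫ quotIncl G' (I.comap φ.left.appTop.hom : Ideal (Alg G')) = quotIncl G I ≫ φ := by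
  haveI : IsAffine (Motives.specOver R (Alg G ⧸ I)).left := inferInstanceAs (IsAffine (Spec (CommRingCat.of (Alg G ⧸ I))))
  refine exists_comp_quotIncl_eq_of_affine G' _ (quotIncl G I ≫ φ) (le_of_eq ?_)
  rw [ker_ptEquiv_isoSpecOver_inv_comp_eq, ker_appTop_comp_eq_comap, ker_appTop_quotIncl]

/-! ## §2 A morphism killing `V(Γ(φ)⁻¹ I)` kills `V(I)` after `φ` -/

/-- **A MORPHISM KILLING `V(Γ(φ)⁻¹ I)` KILLS `V(I)` AFTER `φ`**: for a monoid object `M` over `R` and `g : G′ ⟶ M` with `quotIncl G′ (Γ(φ)⁻¹ I) ≫ g = 1`,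
`quotIncl G I ≫ φ ≫ g = 1` (§1 and Mathlib `MonObj.comp_one`). [cite: GortzWedhorn2023, (27.1.1) and §(27.2) (p. 607)] [cite: Waterhouse1979, §2.1] -/
theorem quotIncl_comp_eq_one_of_comap {M : SchemeOver R} [MonObj M] (φ : G ⟶ G') (I : Ideal (Alg G)) (g : G' ⟶ M)
    (h : quotIncl G' (I.comap φ.left.appTop.hom : Ideal (Alg G')) ≫ g = 1) : quotIncl G I ≫ φ ≫ g = 1 := by
  obtain ⟨y, hy⟩ := exists_comp_quotIncl_comap_eq φ I
  rw [← Category.assoc, ← hy, Category.assoc, h, MonObj.comp_one]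

/-- … and then through a HOMOMORPHISM `χ : M ⟶ M′` of monoid objects: `quotIncl G I ≫ (φ ≫ g ≫ χ) = 1` (Mathlib `MonObj.one_comp`) — the shape of the
conjugated layer map `φ ≫ isogW₀ ≫ ψ` of the L2 organ `stub_TRANSPORT`. [cite: GortzWedhorn2023, (27.1.1) and §(27.2) (p. 607)] [cite: Waterhouse1979, §2.1] -/
theorem quotIncl_comp_comp_eq_one_of_comap {M M' : SchemeOver R} [MonObj M] [MonObj M'] (φ : G ⟶ G') (I : Ideal (Alg G)) (g : G' ⟶ M)
    (χ : M ⟶ M') [IsMonHom χ] (h : quotIncl G' (I.comap φ.left.appTop.hom : Ideal (Alg G')) ≫ g = 1) :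
    quotIncl G I ≫ (φ ≫ g ≫ χ) = 1 := by
  have h1 : quotIncl G I ≫ φ ≫ g = 1 := quotIncl_comp_eq_one_of_comap φ I g h
  rw [← Category.assoc φ, ← Category.assoc (quotIncl G I), ← Category.assoc (quotIncl G I) φ g] at *
  rw [h1, MonObj.one_comp]

end Literature.AlgebraicGeometry.GroupSchemes.AdmIdealTransport

end
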